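import Literature.LinearAlgebra.Matrix.LatimerMacDuffeeSemisimple
import Literature.NumberTheory.ComplexMultiplication.CMAlgebraLatticeClassesFinite
import Literature.LinearAlgebra.TateCommutantDimension
import Literature.RingTheory.DedekindDomain.LatticeSteinitzForm
import Mathlib.NumberTheory.NumberField.Basic
import Mathlib.NumberTheory.NumberField.ClassNumber
import HarnessLib

/-!
# Finiteness of the classes of `T`-stable lattices, I: the ISOTYPIC case (irreducible minimal polynomial) —
# Steinitz's theorem for the `𝒪_K`-hull and the sandwich `d·𝒪_K L ⊆ L ⊆ 𝒪_K L`
# (Marseglia 2025 (ANTS XVI) §3 Prop. 3.1, Thm. 3.2, Rem. 3.3; the Jordan–Zassenhaus theorem, Reiner (26.4))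

[topic LinearAlgebra/Matrix] Lane `lit-hodgefound` (Track 2 foundations library), seat p15 generation 38, row g38-#4.
Sequel of g38-#1 `LatimerMacDuffeeStableLattices` / g38-#3 `LatimerMacDuffeeSemisimple` (the correspondence
`𝓜_{m,c}(ℤ)/∼_ℤ ≃ 𝓛(R,V)/≃_R`): here the FINITENESS of the right-hand side when the minimal polynomial is
IRREDUCIBLE (one field `K = ℚ[x]/(P)`, `V ≅ K^s`); the general semisimple case (finitely many fields, glued along
idempotents) is the sequel row.  THEOREMS ONLY (no definition, no instance, no named fact; D-0026 net Literature debt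
`0`; no `sorry`).  The tree's lattice theory used BY NAME: O'Meara 81:3/81:5/81:8 and Steinitz's theorem
(`Literature.RingTheory.DedekindDomain.Lattice.exists_pseudoBasis`, `….exists_linearEquiv_of_classGroupMk_eq`, seat
p18), the Jordan–Zassenhaus toolkit of `NumberTheory/Automorphic/JordanZassenhaus` (`exists_smul_mem_of_fg`) and
`CMAlgebraLatticeClassesFinite` (`isFullLattice_toSubmodule_integralClosure`).

## Sources, VERBATIM

S. Marseglia, *Modules over orders, conjugacy classes of integral matrices, and abelian varieties over finite fields*,
Res. Number Theory 11 (2025) (ANTS XVI) [Marseglia2025ModulesOverOrders], §3 (held `paper:arxiv-2208.05409`, chunks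
p0006–p0007): «Let `R` be an order in `K` and let `𝔣` be the conductor of `R` in `𝒪`. Denote by `𝓛(R, V)` the
category of sub-`R`-modules of `V` which are also lattices, with `R`-linear morphisms. For every `M` in `𝓛(R, V)`,
the extension `M𝒪` is also a lattice in `V` and hence it belongs to `𝓛(𝒪, V)`. Pick a morphism `φ : M → N` in
`𝓛(R, V)`. Since `RQ = 𝒪Q = K` and `MQ = NQ = V`, the morphism `φ` extends uniquely to a `K`-linear endomorphism of
`V` […]. The following is a restatement of Steinitz Theory. **Proposition 3.1.** Let `M` be in `𝓛(𝒪, V)`. Then there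
are fractional `𝒪_i`-ideals `I_i` and there exists an `𝒪`-linear isomorphism `M ≃ ⊕_{i=1}^n (𝒪_i^{s_i−1} ⊕ I_i)`.
Moreover, the isomorphism class of `M` is uniquely determined by the integers `s_i` and the isomorphism class of the
fractional `𝒪`-ideal `I = I₁ ⊕ … ⊕ I_n`. […] **Theorem 3.2.** Let `M` be in `𝓛(R, V)`. Then there exist an `M′` in
`𝓛(R, V)`, and fractional `𝒪_i`-ideals `I_i` such that (1) `M′ ≃ M` as an `R`-module. (2)
`M′𝒪 = ⊕ (𝒪_i^{s_i−1} ⊕ I_i)`. (3) `⊕ (𝔣_i^{s_i−1} ⊕ 𝔣_iI_i) ⊆ M′ ⊆ ⊕ (𝒪_i^{s_i−1} ⊕ I_i)`. *Proof.* By Proposition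
3.1, there exists an `𝒪`-linear isomorphism `φ : M𝒪 ≃ ⊕ (𝒪_i^{s_i−1} ⊕ I_i)` […]. Define `M′ = φ(M)`. […]
`𝔣M′𝒪 = 𝔣M′ ⊆ M′`, where the last equality holds because `𝔣𝒪 = 𝔣`, and the inclusion follows from `𝔣 ⊆ R` and
`M′R = M′`. **Remark 3.3.** The Jordan-Zassenhaus Theorem [Reiner03] tells us that `Pic(𝒪)` is finite when `Q` is a
global field […]. Then the quotient `𝒬(I)` defined in (2) is a finite abelian group.»

I. Reiner, *Maximal Orders* [Reiner2003MaximalOrders], §26 Thm. (26.4) (Jordan–Zassenhaus): for an `R`-order `Λ` in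
a separable `K`-algebra `A` and any f.g. `A`-module `V`, the `Λ`-lattices `M` with `KM ≅ V` fall into finitely many
isomorphism classes.  C. Hertling, K. Larabi, arXiv:2602.15748 (2026) [HertlingLarabi2026b], §1: «the set of
semisimple matrices in `M_{n×n}(ℤ)` with a fixed characteristic polynomial splits into finitely many
`GL_n(ℤ)`-conjugacy classes» [Za38].

## What is formalised (here `K` is ONE number field — the sources' `n = 1`, `V = K^{s}`; any `s`)

* §1 **«the quotient `𝒬(I)` is a finite abelian group»**: finitely many `ℤ`-submodules between `dN` and a full
  lattice `N` of a `ℚ`-space (`finite_setOf_le_of_smul_mem`; `N/dN` is finite).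
* §2 the order `ℤ[θ]`: for `θ` integral generating `K`, `ℤ[θ]` is a full lattice of `K`
  (`isFullLattice_toSubmodule_adjoin`) and **`d𝒪_K ⊆ ℤ[θ]` for some integer `d ≠ 0`** (`exists_int_smul_mem_adjoin`)
  — «`𝔣` contains an invertible element» for `R = ℤ[θ]`; a `θ`-stable subgroup is `ℤ[θ]`-stable
  (`smul_mem_of_mem_adjoin`).
* §3 for a `θ`-stable full `ℤ`-lattice `M` of a `K`-space `W`: **the hull `M𝒪 = 𝒪_K·M` is a finitely generated
  `𝒪_K`-module spanning `W`, again a full `ℤ`-lattice, and `d·M𝒪 ⊆ M ⊆ M𝒪`** (Theorem 3.2 (3) with `R = ℤ[θ]`,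
  `d ∈ 𝔣`): `le_restrictScalars_span`, `fg_span_of_fg`, `smul_mem_of_mem_span`, `span_span_eq_top`,
  `isLattice_restrictScalars_span`.
* §4 **Proposition 3.1 (Steinitz) as used**: `M𝒪` has a pseudo-basis over a `K`-basis of `W` with invertible
  coefficient ideals (`exists_basis_pseudoBasis_span`, from the tree's `Lattice.exists_pseudoBasis`); two hulls with
  the same Steinitz class are carried onto each other by a `K`-linear automorphism of `W` (the tree's
  `Lattice.exists_linearEquiv_of_classGroupMk_eq`, used by name).
* §5 **THE FINITENESS (isotypic Jordan–Zassenhaus)** `finite_quot_linearEquiv_of_smul_mem`: for a number field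
  `K = ℚ(θ)`, `θ` integral, and a finite-dimensional `K`-space `W`, the `θ`-stable full `ℤ`-lattices of `W` fall into
  FINITELY many orbits under `GL_K(W)` («`Pic(𝒪)` is finite … `𝒬(I)` is finite»: every class has a representative in
  the window `dN ⊆ · ⊆ N` of one of `h_K` reference hulls `N`).
* §6 the same in endomorphism language, **`finite_quot_centralizer_of_irreducible`**: for `T ∈ End_ℚ(W)` killed by an
  IRREDUCIBLE `P ∈ ℚ[x]` and by some monic integer polynomial (e.g. `χ_T ∈ ℤ[x]`), the `T`-stable full `ℤ`-lattices
  of `W` modulo the automorphisms commuting with `T` form a finite type (`K = ℚ[x]/(P)` acting through `T`;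
  `C(T) = GL_K(W)`).
* §7 matrix language, **`finite_quot_conj_of_irreducible`**: with g38-#3's bijection, for any such model `(V, T)` of
  `c = χ_T ∈ ℤ[x]` the semisimple integer matrices with characteristic polynomial `c` form finitely many
  `GL_n(ℤ)`-classes — [Za38] in the isotypic case `c = P^s`; the sequel row removes «irreducible».

## References
* [Marseglia2025ModulesOverOrders] S. Marseglia, Res. Number Theory 11 (2025), §3 Prop. 3.1, Thm. 3.2, Rem. 3.3. [cite: Marseglia2025ModulesOverOrders, §3 Prop. 3.1, Thm. 3.2, Rem. 3.3, chunk p0006]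
* [Reiner2003MaximalOrders] I. Reiner, *Maximal Orders*, §26 Thm. (26.4).
* [HertlingLarabi2026b] C. Hertling, K. Larabi, arXiv:2602.15748, §1 ([Za38] = H. Zassenhaus, Abh. Math. Sem. Hamburg 12 (1938)).
* [Omeara1963] O. T. O'Meara, *Introduction to Quadratic Forms*, §81 (81:3, 81:5, 81:8) — the tree's Steinitz files.
-/

noncomputable section

open scoped Classical nonZeroDivisors NumberField
open Polynomial Module Submodule

namespace Literature.LinearAlgebra.Matrix.StableLatticeClassesIrreducible

open Literature.NumberTheory.Automorphic (IsFullLattice exists_smul_mem_of_fg)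
open Literature.NumberTheory.ComplexMultiplication (isFullLattice_toSubmodule_integralClosure)
open Literature.RingTheory.DedekindDomain

/-! ## §1 Window finiteness in a `ℚ`-vector space -/

section Window

variable {W : Type*} [AddCommGroup W] [Module ℚ W]

/-- **«`𝒬(I)` is a finite abelian group»: between `dN` and a full `ℤ`-lattice `N` of a `ℚ`-space there are only
finitely many subgroups** (`N/dN ≅ (ℤ/d)^r`). [cite: Marseglia2025ModulesOverOrders, §3 Rem. 3.3 («the quotient 𝒬(I) … is a finite abelian group»), chunk p0006] [cite: SwanEvans1970, Ch. 3 Lemma 3.11 (proof)] -/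
theorem finite_setOf_le_of_smul_mem (N : Submodule ℤ W) (hN : N.IsLattice ℚ) {d : ℤ} (hd : d ≠ 0) :
    {L : Submodule ℤ W | L ≤ N ∧ ∀ x ∈ N, d • x ∈ L}.Finite := by
  haveI := hN
  haveI : Module.Finite ℤ N := Module.Finite.iff_fg.mpr hN.fg
  let f : N →ₗ[ℤ] N := DistribSMul.toLinearMap ℤ N d
  have hf : Function.Injective f := fun x y hxy => by
    apply Subtype.ext
    have h : (d : ℚ) • (x : W) = (d : ℚ) • (y : W) := by
      rw [Int.cast_smul_eq_zsmul, Int.cast_smul_eq_zsmul]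
      simpa [f] using congrArg Subtype.val hxy
    exact smul_right_injective W (Int.cast_ne_zero.2 hd) h
  let U : Submodule ℤ N := LinearMap.range f
  haveI hQ : Finite (N ⧸ U) := by
    refine Submodule.finiteQuotientOfFreeOfRankEq U ?_
    exact (LinearEquiv.ofInjective f hf).finrank_eq.symm
  let g : Submodule ℤ W → Set (N ⧸ U) := fun L => U.mkQ '' (L.comap N.subtype : Set N)
  refine Set.Finite.of_finite_image (Set.toFinite _) (f := g) fun L hL L' hL' hLL' => ?_
  have key : ∀ Q : Submodule ℤ W, Q ≤ N → (∀ x ∈ N, d • x ∈ Q) →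
      Subtype.val '' (U.mkQ ⁻¹' (g Q)) = (Q : Set W) := by
    intro Q hQN hQd
    have hsat : U.mkQ ⁻¹' (g Q) = (Q.comap N.subtype : Set N) := by
      ext x
      constructor
      · rintro ⟨y, hy, hyx⟩
        have hxy : x - y ∈ U := by
          rw [← Submodule.Quotient.eq]
          exact hyx.symm
        obtain ⟨z, hz⟩ := hxy
        have : x = f z + y := by rw [hz, sub_add_cancel]
        rw [this]
        exact add_mem (hQd z z.2) hy
      · intro hx
        exact ⟨x, hx, rfl⟩
    rw [hsat]
    ext w
    constructor
    · rintro ⟨x, hx, rfl⟩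
      exact hx
    · intro hw
      exact ⟨⟨w, hQN hw⟩, hw, rfl⟩
  have := key L hL.1 hL.2
  rw [hLL', key L' hL'.1 hL'.2] at this
  exact SetLike.coe_injective this.symm

/-- The image of a full lattice under a linear automorphism is a full lattice. [folklore] -/
private theorem isLattice_map_equiv {L : Submodule ℤ W} (hL : L.IsLattice ℚ) (φ : W ≃ₗ[ℚ] W) :
    (L.map ((φ : W →ₗ[ℚ] W).restrictScalars ℤ)).IsLattice ℚ := by
  refine ⟨hL.fg.map _, ?_⟩
  have h1 : ((L.map ((φ : W →ₗ[ℚ] W).restrictScalars ℤ) : Submodule ℤ W) : Set W) = (φ : W →ₗ[ℚ] W) '' (L : Set W) :=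
    Submodule.map_coe _ _
  rw [h1, Submodule.span_image, hL.span_eq_top, Submodule.map_top, LinearMap.range_eq_top]
  exact φ.surjective

end Window

/-! ## §2 The order `ℤ[θ]` of a number field `K = ℚ(θ)` -/

section Order

variable (K : Type) [Field K] [NumberField K]

/-- For `θ` integral with `ℚ(θ) = K`, **`ℤ[θ]` is a full lattice of `K`** (an order). [cite: Marseglia2025ModulesOverOrders, §2 («An order `R` in `K` is a subring of `K` which is also a lattice in `K`»), chunk p0005] -/
theorem isFullLattice_toSubmodule_adjoin {θ : K} (hθ : IsIntegral ℤ θ) (hgen : Algebra.adjoin ℚ {θ} = ⊤) :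
    IsFullLattice K (Subalgebra.toSubmodule (Algebra.adjoin ℤ ({θ} : Set K))) := by
  refine ⟨hθ.fg_adjoin_singleton, fun x => ?_⟩
  have hx : x ∈ Algebra.adjoin ℚ ({θ} : Set K) := by rw [hgen]; exact Algebra.mem_top
  rw [Algebra.adjoin_singleton_eq_range_aeval] at hx
  obtain ⟨p, rfl⟩ := hx
  obtain ⟨b, hb, hbp⟩ := IsLocalization.integerNormalization_spec (ℤ⁰) p
  refine ⟨b, nonZeroDivisors.ne_zero hb, ?_⟩
  rw [Subalgebra.mem_toSubmodule]
  change b • aeval θ p ∈ _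
  have h1 : b • (aeval θ p : K) = aeval θ (IsLocalization.integerNormalization (ℤ⁰) p) := by
    rw [← map_zsmul (aeval θ) b p, ← hbp, Polynomial.aeval_map_algebraMap]
  rw [h1]
  exact Polynomial.aeval_mem_adjoin_singleton ℤ θ

/-- **The conductor of `ℤ[θ]` contains an integer `d ≠ 0`: `d·𝒪_K ⊆ ℤ[θ]`** («`𝔣` contains an invertible element
of `K` if and only if `𝒪` is finitely generated as a `Z`-module»; here `Z = ℤ`). [cite: Marseglia2025ModulesOverOrders, §2 (the conductor `𝔣 = (R : 𝒪)`), chunk p0005] -/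
theorem exists_int_smul_mem_adjoin {θ : K} (hθ : IsIntegral ℤ θ) (hgen : Algebra.adjoin ℚ {θ} = ⊤) :
    ∃ d : ℤ, d ≠ 0 ∧ ∀ a : K, IsIntegral ℤ a → d • a ∈ Algebra.adjoin ℤ ({θ} : Set K) := by
  obtain ⟨d, hd, h⟩ := exists_smul_mem_of_fg (isFullLattice_toSubmodule_adjoin K hθ hgen)
    (isFullLattice_toSubmodule_integralClosure K).1
  exact ⟨d, hd, fun a ha => (Subalgebra.mem_toSubmodule _).1 (h a ((Subalgebra.mem_toSubmodule _).2
    ((mem_integralClosure_iff ℤ K).2 ha)))⟩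

variable {K}
variable {W : Type*} [AddCommGroup W] [Module K W]

omit [NumberField K] in
/-- A `θ`-stable subgroup of a `K`-module is `ℤ[θ]`-stable. [cite: Marseglia2025ModulesOverOrders, §3 («`M′R = M′`»), chunk p0006] -/
theorem smul_mem_of_mem_adjoin {θ : K} {M : Submodule ℤ W} (hM : ∀ x ∈ M, θ • x ∈ M) {a : K}
    (ha : a ∈ Algebra.adjoin ℤ ({θ} : Set K)) {x : W} (hx : x ∈ M) : a • x ∈ M := by
  induction ha using Algebra.adjoin_induction generalizing x with
  | mem a ha => rw [Set.mem_singleton_iff] at ha; rw [ha]; exact hM x hx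
  | algebraMap r => rw [algebraMap_smul]; exact M.smul_mem r hx
  | add a b _ _ iha ihb => rw [add_smul]; exact add_mem (iha hx) (ihb hx)
  | mul a b _ _ iha ihb => rw [mul_smul]; exact iha (ihb hx)

end Order

/-! ## §3 The `𝒪_K`-hull `M𝒪` of a `θ`-stable lattice and the sandwich `d·M𝒪 ⊆ M ⊆ M𝒪` -/

section Hull

variable {K : Type} [Field K] [NumberField K]
variable {W : Type*} [AddCommGroup W] [Module K W] [Module ℚ W] [IsScalarTower ℚ K W]

omit [NumberField K] [Module ℚ W] [IsScalarTower ℚ K W] in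
/-- `M ⊆ M𝒪`. [cite: Marseglia2025ModulesOverOrders, §3 Thm. 3.2 (proof, «`M′ ⊆ M′𝒪`»), chunk p0006] -/
theorem le_restrictScalars_span [Module (𝓞 K) W] [IsScalarTower (𝓞 K) K W] (M : Submodule ℤ W) :
    M ≤ (Submodule.span (𝓞 K) (M : Set W)).restrictScalars ℤ := fun _ hx => Submodule.subset_span hx

omit [NumberField K] [Module ℚ W] [IsScalarTower ℚ K W] in
/-- **`M𝒪` is finitely generated over `𝒪`** (by the generators of `M`). [cite: Marseglia2025ModulesOverOrders, §3 («the extension `M𝒪` is also a lattice in `V`»), chunk p0006] -/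
theorem fg_span_of_fg [Module (𝓞 K) W] [IsScalarTower (𝓞 K) K W] {M : Submodule ℤ W} (hM : M.FG) :
    (Submodule.span (𝓞 K) (M : Set W)).FG := by
  obtain ⟨s, hs⟩ := hM
  refine ⟨s, ?_⟩
  rw [← hs, Submodule.span_span_of_tower]

omit [NumberField K] [Module ℚ W] [IsScalarTower ℚ K W] in
/-- **`d·M𝒪 ⊆ M`** for `M` `θ`-stable and `d𝒪_K ⊆ ℤ[θ]` («`𝔣M′𝒪 = 𝔣M′ ⊆ M′` … from `𝔣 ⊆ R` and `M′R = M′`»).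
[cite: Marseglia2025ModulesOverOrders, §3 Thm. 3.2 (3) and proof, chunk p0006] -/
theorem smul_mem_of_mem_span [Module (𝓞 K) W] [IsScalarTower (𝓞 K) K W] {θ : K} {d : ℤ}
    (hd : ∀ a : K, IsIntegral ℤ a → d • a ∈ Algebra.adjoin ℤ ({θ} : Set K)) {M : Submodule ℤ W}
    (hM : ∀ x ∈ M, θ • x ∈ M) {x : W} (hx : x ∈ Submodule.span (𝓞 K) (M : Set W)) : d • x ∈ M := by
  -- the stronger statement `(d·a)·x ∈ M` for every `a ∈ 𝒪_K` is stable under the `𝒪_K`-span operations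
  suffices h : ∀ a : 𝓞 K, (d • (a : K)) • x ∈ M by
    have h1 := h 1
    rwa [show ((1 : 𝓞 K) : K) = 1 from map_one _, smul_assoc, one_smul] at h1
  induction hx using Submodule.span_induction with
  | mem y hy => exact fun a => smul_mem_of_mem_adjoin hM (hd _ (NumberField.RingOfIntegers.isIntegral_coe a)) hy
  | zero => exact fun a => by rw [smul_zero]; exact M.zero_mem
  | add y z _ _ hy hz => exact fun a => by rw [smul_add]; exact add_mem (hy a) (hz a)
  | smul c y _ ih =>
    intro a
    have h2 : (d • (a : K)) • (c • y) = (d • ((a * c : 𝓞 K) : K)) • y := by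
      rw [← IsScalarTower.algebraMap_smul K c y, smul_smul, smul_mul_assoc]
      simp only [NumberField.RingOfIntegers.coe_eq_algebraMap, map_mul]
    rw [h2]
    exact ih (a * c)

/-- **`M𝒪` spans `W` over `K`** when `M` spans `W` over `ℚ` («`MQ = NQ = V`»). [cite: Marseglia2025ModulesOverOrders, §3 (before Prop. 3.1), chunk p0006] -/
theorem span_span_eq_top [Module (𝓞 K) W] [IsScalarTower (𝓞 K) K W] {M : Submodule ℤ W}
    (hM : Submodule.span ℚ (M : Set W) = ⊤) :
    Submodule.span K ((Submodule.span (𝓞 K) (M : Set W) : Submodule (𝓞 K) W) : Set W) = ⊤ := by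
  have h1 : ∀ x : W, x ∈ Submodule.span K (M : Set W) := fun x =>
    Submodule.span_le_restrictScalars ℚ K (M : Set W)
      (show x ∈ Submodule.span ℚ (M : Set W) by rw [hM]; exact Submodule.mem_top)
  exact Submodule.eq_top_iff'.mpr fun x => Submodule.span_mono Submodule.subset_span (h1 x)

omit [IsScalarTower ℚ K W] in
/-- **`M𝒪` is again a full `ℤ`-lattice** («the extension `M𝒪` is also a lattice in `V`»). [cite: Marseglia2025ModulesOverOrders, §3 (before Prop. 3.1), chunk p0006] -/
theorem isLattice_restrictScalars_span [Module (𝓞 K) W] [IsScalarTower (𝓞 K) K W] {M : Submodule ℤ W}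
    (hM : M.IsLattice ℚ) : ((Submodule.span (𝓞 K) (M : Set W)).restrictScalars ℤ).IsLattice ℚ := by
  refine ⟨(fg_span_of_fg hM.fg).restrictScalars, ?_⟩
  rw [← top_le_iff, ← hM.span_eq_top]
  exact Submodule.span_mono (le_restrictScalars_span M)

/-! ## §4 Proposition 3.1 (Steinitz) for the hull -/

/-- **Proposition 3.1 as used: the hull `M𝒪` of a full lattice has a pseudo-basis `M𝒪 = 𝔞₁b₁ + ⋯ + 𝔞ₙbₙ` over a
`K`-basis `b` of `W`, with invertible fractional ideals `𝔞ᵢ`** (O'Meara 81:3 through the tree's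
`Lattice.exists_pseudoBasis`). [cite: Marseglia2025ModulesOverOrders, §3 Prop. 3.1 («a restatement of Steinitz Theory»), chunk p0006] [cite: Omeara1963, §81B Thm. 81:3, p. 211] -/
theorem exists_basis_pseudoBasis_span [FiniteDimensional ℚ W] [Module (𝓞 K) W] [IsScalarTower (𝓞 K) K W]
    {M : Submodule ℤ W} (hM : M.IsLattice ℚ) :
    ∃ (b : Basis (Fin (finrank K W)) K W) (𝔞 : Fin (finrank K W) → (FractionalIdeal (𝓞 K)⁰ K)ˣ),
      ∀ v : W, v ∈ Submodule.span (𝓞 K) (M : Set W) ↔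
        ∃ c : Fin (finrank K W) → K, (∀ i, c i ∈ ((𝔞 i : FractionalIdeal (𝓞 K)⁰ K))) ∧
          v = ∑ i, c i • b i := by
  haveI : Module.Finite K W := Module.Finite.of_restrictScalars_finite ℚ K W
  obtain ⟨n, y, 𝔞, hn, hli, h𝔞0, -, hiff⟩ :=
    Lattice.exists_pseudoBasis (K := K) (Submodule.span (𝓞 K) (M : Set W)) (fg_span_of_fg hM.fg)
  rw [span_span_eq_top hM.span_eq_top, finrank_top] at hn
  subst hn
  refine ⟨basisOfLinearIndependentOfCardEqFinrank' y hli (Fintype.card_fin _),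
    fun i => Units.mk0 (𝔞 i) (h𝔞0 i), fun v => ?_⟩
  simp only [coe_basisOfLinearIndependentOfCardEqFinrank', Units.val_mk0]
  exact hiff v

end Hull

/-! ## §5 The finiteness: `θ`-stable lattices of a `K`-space modulo `GL_K(W)` (isotypic Jordan–Zassenhaus) -/

section Finite

variable {K : Type} [Field K] [NumberField K]
variable {W : Type*} [AddCommGroup W] [Module K W] [Module ℚ W] [IsScalarTower ℚ K W] [FiniteDimensional ℚ W]

omit [NumberField K] [Module ℚ W] [IsScalarTower ℚ K W] [FiniteDimensional ℚ W] in
/-- A `K`-linear automorphism carries `θ`-stable subgroups to `θ`-stable subgroups. [cite: Marseglia2025ModulesOverOrders, §3 Thm. 3.2 (proof, «Define `M′ = φ(M)`»), chunk p0006] -/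
theorem smul_mem_map_of_smul_mem {θ : K} {M : Submodule ℤ W} (hM : ∀ x ∈ M, θ • x ∈ M) (f : W ≃ₗ[K] W)
    {y : W} (hy : y ∈ M.map ((f : W →ₗ[K] W).restrictScalars ℤ)) :
    θ • y ∈ M.map ((f : W →ₗ[K] W).restrictScalars ℤ) := by
  obtain ⟨x, hx, rfl⟩ := hy
  exact ⟨θ • x, hM x hx, by simp⟩

omit [FiniteDimensional ℚ W] in
/-- A `K`-linear automorphism carries full `ℤ`-lattices to full `ℤ`-lattices. [cite: Marseglia2025ModulesOverOrders, §3 Thm. 3.2 (1)–(2) («`M′ ≃ M`», `M′ = φ(M)` a lattice), chunk p0006] -/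
theorem isLattice_map {M : Submodule ℤ W} (hM : M.IsLattice ℚ) (f : W ≃ₗ[K] W) :
    (M.map ((f : W →ₗ[K] W).restrictScalars ℤ)).IsLattice ℚ := by
  refine ⟨hM.fg.map _, ?_⟩
  have h1 : ((M.map ((f : W →ₗ[K] W).restrictScalars ℤ) : Submodule ℤ W) : Set W) =
      ((f.restrictScalars ℚ : W ≃ₗ[ℚ] W) : W →ₗ[ℚ] W) '' (M : Set W) :=
    Submodule.map_coe _ _
  rw [h1, Submodule.span_image, hM.span_eq_top, Submodule.map_top, LinearMap.range_eq_top]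
  exact (f.restrictScalars ℚ).surjective

/-- **THE ISOTYPIC JORDAN–ZASSENHAUS THEOREM (module form of Thm. 3.2 + Rem. 3.3).**  Let `K = ℚ(θ)` be a number
field with `θ` an algebraic integer and `W` a finite-dimensional `K`-vector space.  Then the `θ`-stable (equivalently
`ℤ[θ]`-stable) full `ℤ`-lattices `M ⊂ W` fall into **finitely many orbits under the `K`-linear automorphisms of
`W`**: every `M` is carried by some `φ ∈ GL_K(W)` into the window `d·N ⊆ φ(M) ⊆ N` of one of `h_K` reference hulls
`N` (Steinitz class of `M𝒪_K`; `d𝒪_K ⊆ ℤ[θ]`), and each window holds finitely many lattices. [cite: Marseglia2025ModulesOverOrders, §3 Prop. 3.1, Thm. 3.2, Rem. 3.3, chunk p0006] [cite: Reiner2003MaximalOrders, §26 Thm. (26.4) (Jordan–Zassenhaus)] -/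
theorem finite_quot_linearEquiv_of_smul_mem {θ : K} (hθ : IsIntegral ℤ θ) (hgen : Algebra.adjoin ℚ {θ} = ⊤) :
    Finite (Quot (fun M M' : {M : Submodule ℤ W // M.IsLattice ℚ ∧ ∀ x ∈ M, θ • x ∈ M} =>
      ∃ φ : W ≃ₗ[K] W, M.1.map ((φ : W →ₗ[K] W).restrictScalars ℤ) = M'.1)) := by
  classical
  -- the `𝒪_K`-module structure of `W` through `K`
  letI : Module (𝓞 K) W := Module.compHom W (algebraMap (𝓞 K) K)
  haveI : IsScalarTower (𝓞 K) K W := IsScalarTower.of_algebraMap_smul fun _ _ => rfl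
  set X := {M : Submodule ℤ W // M.IsLattice ℚ ∧ ∀ x ∈ M, θ • x ∈ M} with hX
  rcases isEmpty_or_nonempty X with h0 | ⟨⟨M₀⟩⟩
  · exact Finite.of_surjective _ Quot.mk_surjective
  -- `d𝒪_K ⊆ ℤ[θ]`
  obtain ⟨d, hd, hdO⟩ := exists_int_smul_mem_adjoin K hθ hgen
  -- Steinitz data of every hull (Prop. 3.1)
  have hull : ∀ M : X, ∃ (b : Basis (Fin (finrank K W)) K W)
      (𝔞 : Fin (finrank K W) → (FractionalIdeal (𝓞 K)⁰ K)ˣ),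
      ∀ v : W, v ∈ Submodule.span (𝓞 K) (M.1 : Set W) ↔
        ∃ c : Fin (finrank K W) → K, (∀ i, c i ∈ ((𝔞 i : FractionalIdeal (𝓞 K)⁰ K))) ∧
          v = ∑ i, c i • b i := fun M => exists_basis_pseudoBasis_span M.2.1
  choose b 𝔞 hb using hull
  -- the Steinitz class of the hull
  let κ : X → ClassGroup (𝓞 K) := fun M => ClassGroup.mk K (∏ i, 𝔞 M i)
  have hiso : ∀ M M' : X, κ M = κ M' → ∃ f : W ≃ₗ[K] W,
      ∀ v : W, v ∈ Submodule.span (𝓞 K) (M.1 : Set W) ↔ f v ∈ Submodule.span (𝓞 K) (M'.1 : Set W) :=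
    fun M M' h => Lattice.exists_linearEquiv_of_classGroupMk_eq (b M) (b M') (𝔞 M) (𝔞 M') (hb M) (hb M') h
  -- one reference lattice per class (Pic is finite: `h_K` of them)
  let Mrep : ClassGroup (𝓞 K) → X := fun k => if h : ∃ M : X, κ M = k then h.choose else M₀
  have hMrep : ∀ M : X, κ (Mrep (κ M)) = κ M := fun M => by
    have h : ∃ M' : X, κ M' = κ M := ⟨M, rfl⟩
    simp only [Mrep, dif_pos h]
    exact h.choose_spec
  let N : ClassGroup (𝓞 K) → Submodule ℤ W := fun k =>
    (Submodule.span (𝓞 K) ((Mrep k).1 : Set W)).restrictScalars ℤ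
  have hN : ∀ k, (N k).IsLattice ℚ := fun k => isLattice_restrictScalars_span (Mrep k).2.1
  -- the windows `dN ⊆ L ⊆ N` are finite (Rem. 3.3)
  haveI hfin : ∀ k, Finite {L : Submodule ℤ W // L ≤ N k ∧ ∀ x ∈ N k, d • x ∈ L} := fun k =>
    (finite_setOf_le_of_smul_mem (N k) (hN k) hd).to_subtype
  let g : (Σ k : ClassGroup (𝓞 K), {L : Submodule ℤ W // L ≤ N k ∧ ∀ x ∈ N k, d • x ∈ L}) → Quot _ :=
    fun p => if h : p.2.1.IsLattice ℚ ∧ ∀ x ∈ p.2.1, θ • x ∈ p.2.1 then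
      Quot.mk (fun M M' : X => ∃ φ : W ≃ₗ[K] W, M.1.map ((φ : W →ₗ[K] W).restrictScalars ℤ) = M'.1) ⟨p.2.1, h⟩
      else Quot.mk _ M₀
  refine Finite.of_surjective g ?_
  rintro ⟨M⟩
  -- Thm. 3.2: move `M` by `φ ∈ GL_K(W)` so that its hull becomes the reference hull of its class
  obtain ⟨f, hf⟩ := hiso M (Mrep (κ M)) (hMrep M).symm
  let L : Submodule ℤ W := M.1.map ((f : W →ₗ[K] W).restrictScalars ℤ)
  have hL1 : L ≤ N (κ M) := by
    rintro _ ⟨x, hx, rfl⟩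
    exact (hf x).1 (Submodule.subset_span hx)
  have hL2 : ∀ x ∈ N (κ M), d • x ∈ L := fun x hx => by
    have hx' : f.symm x ∈ Submodule.span (𝓞 K) (M.1 : Set W) := by
      rw [hf, LinearEquiv.apply_symm_apply]; exact hx
    refine ⟨d • f.symm x, smul_mem_of_mem_span hdO M.2.2 hx', ?_⟩
    simp
  have hLlat : L.IsLattice ℚ := isLattice_map M.2.1 f
  have hLθ : ∀ x ∈ L, θ • x ∈ L := fun x hx => smul_mem_map_of_smul_mem M.2.2 f hx
  refine ⟨⟨κ M, L, hL1, hL2⟩, ?_⟩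
  simp only [g, dif_pos (show L.IsLattice ℚ ∧ ∀ x ∈ L, θ • x ∈ L from ⟨hLlat, hLθ⟩)]
  exact (Quot.sound ⟨f, rfl⟩).symm

end Finite

/-! ## §6 Endomorphism form: `T` with irreducible minimal polynomial -/

/-- **Jordan–Zassenhaus for one simple factor, endomorphism form.**  Let `T` be an endomorphism of a finite-dimensional
`ℚ`-space `W` killed by an IRREDUCIBLE polynomial `P` and by some monic INTEGER polynomial `c` (e.g. `T` with
integral characteristic polynomial `P^s`).  Then the `T`-stable full `ℤ`-lattices of `W`, modulo the `ℚ`-automorphisms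
commuting with `T`, form a **finite** type: `W` is a vector space over the number field `K = ℚ[x]/(P)` (`x ↦ T`),
`T`-stable = `θ`-stable for the algebraic integer `θ = x̄`, and `C(T) = GL_K(W)` — so this is
`finite_quot_linearEquiv_of_smul_mem`.  With g38-#3 (`m = P`, `c = P^s`): `𝓜_{m,c}(ℤ)/∼_ℤ` is finite; «semisimple
matrices with a fixed characteristic polynomial split into finitely many `GL_n(ℤ)`-conjugacy classes» [Za38] in the
isotypic case. [cite: Marseglia2025ModulesOverOrders, §3 Thm. 3.2, Rem. 3.3 with §4 Thm. 4.1, chunks p0006–p0008] [cite: HertlingLarabi2026b, §1 (Jordan–Zassenhaus [Za38])] [cite: Reiner2003MaximalOrders, §26 Thm. (26.4)] -/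
theorem finite_quot_centralizer_of_irreducible {W : Type*} [AddCommGroup W] [Module ℚ W] [FiniteDimensional ℚ W]
    (T : Module.End ℚ W) {P : ℚ[X]} (hP : Irreducible P) (hPT : aeval T P = 0)
    {c : ℤ[X]} (hc : c.Monic) (hcT : aeval T (c.map (Int.castRingHom ℚ)) = 0) :
    Finite (Quot (fun L L' : {L : Submodule ℤ W // L.IsLattice ℚ ∧ ∀ x ∈ L, T x ∈ L} =>
      ∃ φ : W ≃ₗ[ℚ] W, (φ : W →ₗ[ℚ] W) ∘ₗ T = T ∘ₗ (φ : W →ₗ[ℚ] W) ∧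
        L.1.map ((φ : W →ₗ[ℚ] W).restrictScalars ℤ) = L'.1)) := by
  classical
  rcases subsingleton_or_nontrivial W with hW | hW
  · haveI : Subsingleton (Submodule ℤ W) := (Submodule.subsingleton_iff ℤ).mpr hW
    exact Finite.of_surjective _ Quot.mk_surjective
  haveI : Fact (Irreducible P) := ⟨hP⟩
  -- `K = ℚ[x]/(P)` acting on `W` through `x ↦ T`
  have hI : ∀ q ∈ Ideal.span ({P} : Set ℚ[X]), aeval T q = 0 := fun q hq => by
    obtain ⟨r, rfl⟩ := Ideal.mem_span_singleton'.mp hq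
    rw [map_mul, hPT, mul_zero]
  let φK : AdjoinRoot P →ₐ[ℚ] Module.End ℚ W := Ideal.Quotient.liftₐ (Ideal.span {P}) (aeval T) hI
  have hφ_mk : ∀ q : ℚ[X], φK (AdjoinRoot.mk P q) = aeval T q := fun q => rfl
  have hφ_root : φK (AdjoinRoot.root P) = T := by
    rw [AdjoinRoot.root, hφ_mk, aeval_X]
  letI : Module (AdjoinRoot P) W := Module.compHom W φK.toRingHom
  have hsmul : ∀ (a : AdjoinRoot P) (w : W), a • w = φK a w := fun _ _ => rfl
  haveI : IsScalarTower ℚ (AdjoinRoot P) W := IsScalarTower.of_algebraMap_smul fun q w => by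
    -- `ℚ → K` is unique, so `φK ∘ (ℚ → K) = (ℚ → End W)` whichever `ℚ`-algebra structure of `K` is meant
    have halg : ∀ g : ℚ →+* AdjoinRoot P, φK (g q) = algebraMap ℚ (Module.End ℚ W) q := fun g => by
      rw [Subsingleton.elim g ((AdjoinRoot.mk P).comp C), RingHom.comp_apply, hφ_mk, aeval_C]
    rw [hsmul, halg, Module.algebraMap_end_apply]
  have hθ : ∀ w : W, AdjoinRoot.root P • w = T w := fun w => by rw [hsmul, hφ_root]
  -- `θ = x̄` is an algebraic integer: `c(θ) ↦ c(T) = 0` under the injection `K ↪ End_ℚ(W)`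
  have hinj : Function.Injective φK := φK.toRingHom.injective
  have hint : IsIntegral ℤ (AdjoinRoot.root P) := by
    refine ⟨c, hc, ?_⟩
    rw [← Polynomial.aeval_def, ← Polynomial.aeval_map_algebraMap ℚ (AdjoinRoot.root P) c, algebraMap_int_eq]
    apply hinj
    rw [map_zero, ← Polynomial.aeval_algHom_apply, hφ_root, hcT]
  have hgen : Algebra.adjoin ℚ ({AdjoinRoot.root P} : Set (AdjoinRoot P)) = ⊤ := AdjoinRoot.adjoinRoot_eq_top
  haveI hfinK := finite_quot_linearEquiv_of_smul_mem (K := AdjoinRoot P) (W := W) hint hgen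
  -- same lattices, same relation
  set rK := (fun M M' : {M : Submodule ℤ W // M.IsLattice ℚ ∧ ∀ x ∈ M, AdjoinRoot.root P • x ∈ M} =>
    ∃ φ : W ≃ₗ[AdjoinRoot P] W, M.1.map ((φ : W →ₗ[AdjoinRoot P] W).restrictScalars ℤ) = M'.1) with hrK
  let e : {L : Submodule ℤ W // L.IsLattice ℚ ∧ ∀ x ∈ L, T x ∈ L} ≃
      {M : Submodule ℤ W // M.IsLattice ℚ ∧ ∀ x ∈ M, AdjoinRoot.root P • x ∈ M} :=
    Equiv.subtypeEquivRight fun L => by simp_rw [hθ]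
  refine Finite.of_equiv (Quot rK) (Quot.congr (rb := rK) e fun L L' => ?_).symm
  constructor
  · rintro ⟨φ, hφT, hmap⟩
    have hTφ : T * (φ : Module.End ℚ W) = (φ : Module.End ℚ W) * T := hφT.symm
    have hcomm : ∀ a : AdjoinRoot P, φK a * (φ : Module.End ℚ W) = (φ : Module.End ℚ W) * φK a := by
      intro a
      induction a using AdjoinRoot.induction_on with
      | ih q => rw [hφ_mk]; exact Literature.LinearAlgebra.aeval_mul_eq_mul_aeval_of_commute hTφ q
    let ψ : W ≃ₗ[AdjoinRoot P] W :=
      { toFun := φ, invFun := φ.symm, map_add' := fun x y => φ.map_add x y,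
        map_smul' := fun a w => by
          rw [RingHom.id_apply, hsmul, hsmul]
          exact (LinearMap.congr_fun (hcomm a) w).symm
        left_inv := φ.left_inv, right_inv := φ.right_inv }
    refine ⟨ψ, ?_⟩
    have hψ : ((ψ : W →ₗ[AdjoinRoot P] W).restrictScalars ℤ) = (φ : W →ₗ[ℚ] W).restrictScalars ℤ :=
      LinearMap.ext fun _ => rfl
    change L.1.map ((ψ : W →ₗ[AdjoinRoot P] W).restrictScalars ℤ) = L'.1
    rw [hψ]; exact hmap
  · rintro ⟨ψ, hmap⟩
    refine ⟨ψ.restrictScalars ℚ, ?_, ?_⟩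
    · ext w
      change ψ (T w) = T (ψ w)
      rw [← hθ, ← hθ, LinearEquiv.map_smul]
    · exact hmap

/-! ## §7 Matrix form: `𝓜_{m,c}(ℤ)/∼_ℤ` is finite for `m` irreducible -/

/-- **Finitely many `GL_n(ℤ)`-classes of semisimple integer matrices with characteristic polynomial `c = P^s`, `P`
irreducible** — the isotypic case of «the set of semisimple matrices in `M_{n×n}(ℤ)` with a fixed characteristic
polynomial splits into finitely many `GL_n(ℤ)`-conjugacy classes» [Za38]: for ANY finite-dimensional `(V, T)` with
`P(T) = 0`, `P` irreducible, and `χ_T = c ∈ ℤ[x]`, the integer matrices `B` with `B` semisimple and `χ_B = c`, modulo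
`B ∼ B' :⟺ PB = B'P` for some `P ∈ GL_n(ℤ)`, form a finite type (g38-#3's bijection `𝓜_{m,c}(ℤ)/∼_ℤ ≃ 𝓛(R,V)/≃_R`
composed with `finite_quot_centralizer_of_irreducible`). [cite: HertlingLarabi2026b, §1 (Jordan–Zassenhaus [Za38])] [cite: Marseglia2025ModulesOverOrders, §3 Thm. 3.2, Rem. 3.3 and §4 Thm. 4.1, chunks p0006–p0008] [cite: Marseglia2019, §8 Thm. 8.1, pp. 14–15] -/
theorem finite_quot_conj_of_irreducible {V : Type*} [AddCommGroup V] [Module ℚ V] [FiniteDimensional ℚ V] {n : ℕ}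
    (hn : finrank ℚ V = n) (T : Module.End ℚ V) {P : ℚ[X]} (hP : Irreducible P) (hPT : aeval T P = 0)
    {c : ℤ[X]} (hc : T.charpoly = c.map (Int.castRingHom ℚ)) :
    Finite (Quot (fun B B' : {B : _root_.Matrix (Fin n) (Fin n) ℤ //
        Module.End.IsSemisimple (Matrix.toLin' (B.map (Int.castRingHom ℚ))) ∧ B.charpoly = c} =>
      ∃ P : _root_.Matrix (Fin n) (Fin n) ℤ, IsUnit P.det ∧ P * B.1 = B'.1 * P)) := by
  have hT : T.IsSemisimple := Module.End.isSemisimple_of_squarefree_aeval_eq_zero hP.squarefree hPT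
  have hcm : c.Monic := by
    refine Polynomial.monic_of_injective (Int.castRingHom ℚ).injective_int ?_
    rw [← hc]; exact T.charpoly_monic
  have hcT : aeval T (c.map (Int.castRingHom ℚ)) = 0 := by rw [← hc]; exact T.aeval_self_charpoly
  haveI := finite_quot_centralizer_of_irreducible T hP hPT hcm hcT
  obtain ⟨Φ, -⟩ :=
    LatimerMacDuffeeSemisimple.exists_equiv_quot_conj_quot_centralizer_of_isSemisimple hn T hT hc
  exact Finite.of_equiv _ Φ.symm

end Literature.LinearAlgebra.Matrix.StableLatticeClassesIrreducible
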